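import Mathlib
import HarnessLib
import Literature.Probability.LatticeModels.LatticeGreenPoisson
import Summits.QuantumFields.YangMills.Theses.U1DipoleHelicity

/-!
# `FreeDipoleBoxMeanHalf` — the box mean of the free lattice photon kernel is exactly one half

Route `U1DipoleHelicity` (LINE 4 of the ideator cell ym-idea-2; an abelian COMPARISON line onto the
node `Theorems.U1HelicityGapD4`, not a rung of `YangMills`), support item stmt-QuantumFields-25882
`Summit.QuantumFields.YangMills.Theses.U1DipoleHelicity.FreeDipoleBoxMeanHalf`:
with the free lattice photon kernel of the field strength `F₀₁`,
`K(z) = (2π)⁻⁴ ∫_{[-π,π]⁴} cos(k·z) · (k̂₀² + k̂₁²)/Σ_μ k̂_μ² dk`, `k̂_μ = 2 sin(k_μ/2)`,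
the box averages `(1/#B_N) Σ_{x,y ∈ B_N} K(x − y)` tend to `1/2`.

Proof (planner ym-idea-2 g2 / critic idea-crit-4 P2, `freeK_datum.md`): the sequence is CONSTANT,
equal to `1/2` for every `N`.  Writing `s₀₁(k) = (k̂₀² + k̂₁²)/k̂²` and `s₂₃(k) = (k̂₂² + k̂₃²)/k̂²`,
one has `s₀₁ + s₂₃ = 1` off the Lebesgue-null set `{k̂² = 0}`; the coordinate-pair swap
`T : (k₀,k₁,k₂,k₃) ↦ (k₂,k₃,k₀,k₁)` preserves Lebesgue measure and the Brillouin zone and carries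
`s₀₁` to `s₂₃`, so `K(z) + K(Tz) = (2π)⁻⁴ ∫_{[-π,π]⁴} cos(k·z) dk = [z = 0]` (orthogonality of
characters, the tree's `integral_brillouin_cos_sum_mul`); and `T` maps the cube `B_N = {-N,…,N}⁴`
to itself, so `Σ_{x,y∈B_N} K(x−y) = Σ_{x,y∈B_N} K(T(x−y))`, whence
`2 Σ_{x,y∈B_N} K(x−y) = Σ_{x,y∈B_N} [x = y] = #B_N`.

Nothing here bears on the Yang–Mills mass gap: the line is the abelian comparison statement
(Wilson U(1)₄ masslessness), and this file is its elementary lattice-Fourier support lemma.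
-/

namespace Summit.QuantumFields.YangMills.Theorems.U1DipoleHelicity

open MeasureTheory Finset Literature.Probability.LatticeModels
open scoped BigOperators Real

/-! ### The coordinate-pair swap `(k₀,k₁,k₂,k₃) ↦ (k₂,k₃,k₀,k₁)` -/

/-- The coordinate-pair swap on momenta is measurable. [folklore] -/
theorem measurable_swapPairs :
    Measurable (fun k : Fin 4 → ℝ => (![k 2, k 3, k 0, k 1] : Fin 4 → ℝ)) := by
  refine measurable_pi_iff.2 fun i => ?_
  fin_cases i <;> simpa using measurable_pi_apply _

/-- The coordinate-pair swap is an involution. [folklore] -/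
theorem swapPairs_swapPairs (k : Fin 4 → ℝ) :
    (![(![k 2, k 3, k 0, k 1] : Fin 4 → ℝ) 2, (![k 2, k 3, k 0, k 1] : Fin 4 → ℝ) 3,
        (![k 2, k 3, k 0, k 1] : Fin 4 → ℝ) 0, (![k 2, k 3, k 0, k 1] : Fin 4 → ℝ) 1] : Fin 4 → ℝ)
      = k := by
  funext i
  fin_cases i <;> simp

/-- The coordinate-pair swap preserves Lebesgue measure on `ℝ⁴` (it permutes the factors of the
product measure). [folklore] -/
theorem measurePreserving_swapPairs :
    MeasurePreserving (fun k : Fin 4 → ℝ => (![k 2, k 3, k 0, k 1] : Fin 4 → ℝ)) volume volume := by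
  refine ⟨measurable_swapPairs, ?_⟩
  rw [volume_pi]
  symm
  refine Measure.pi_eq fun s hs => ?_
  rw [Measure.map_apply measurable_swapPairs (MeasurableSet.univ_pi hs)]
  have hpre : (fun k : Fin 4 → ℝ => (![k 2, k 3, k 0, k 1] : Fin 4 → ℝ)) ⁻¹' Set.pi Set.univ s =
      Set.pi Set.univ (![s 2, s 3, s 0, s 1] : Fin 4 → Set ℝ) := by
    ext k
    simp only [Set.mem_preimage, Set.mem_univ_pi]
    constructor
    · intro h i
      fin_cases i
      · simpa using h 2
      · simpa using h 3
      · simpa using h 0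
      · simpa using h 1
    · intro h i
      fin_cases i
      · simpa using h 2
      · simpa using h 3
      · simpa using h 0
      · simpa using h 1
  rw [hpre, Measure.pi_pi]
  simp only [Fin.prod_univ_four, Matrix.cons_val_zero, Matrix.cons_val_one, Matrix.cons_val]
  ring

/-- The coordinate-pair swap as a measurable equivalence of `ℝ⁴` (its own inverse). [folklore] -/
theorem measurableEmbedding_swapPairs :
    MeasurableEmbedding (fun k : Fin 4 → ℝ => (![k 2, k 3, k 0, k 1] : Fin 4 → ℝ)) :=
  ({ toFun := fun k : Fin 4 → ℝ => (![k 2, k 3, k 0, k 1] : Fin 4 → ℝ)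
     invFun := fun k : Fin 4 → ℝ => (![k 2, k 3, k 0, k 1] : Fin 4 → ℝ)
     left_inv := fun k => swapPairs_swapPairs k
     right_inv := fun k => swapPairs_swapPairs k
     measurable_toFun := measurable_swapPairs
     measurable_invFun := measurable_swapPairs } : (Fin 4 → ℝ) ≃ᵐ (Fin 4 → ℝ)).measurableEmbedding

/-- The Brillouin zone `[-π,π]⁴` is invariant under the coordinate-pair swap. [folklore] -/
theorem swapPairs_preimage_brillouin :
    (fun k : Fin 4 → ℝ => (![k 2, k 3, k 0, k 1] : Fin 4 → ℝ)) ⁻¹' brillouin 4 = brillouin 4 := by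
  ext k
  simp only [brillouin, Set.mem_preimage, Set.mem_univ_pi]
  constructor
  · intro h i
    fin_cases i
    · simpa using h 2
    · simpa using h 3
    · simpa using h 0
    · simpa using h 1
  · intro h i
    fin_cases i
    · simpa using h 2
    · simpa using h 3
    · simpa using h 0
    · simpa using h 1

/-- **Change of variables under the coordinate-pair swap**: for every `g`,
`∫_{[-π,π]⁴} g(k₂,k₃,k₀,k₁) dk = ∫_{[-π,π]⁴} g(k) dk`. [folklore] -/
theorem setIntegral_brillouin_comp_swapPairs (g : (Fin 4 → ℝ) → ℝ) :
    ∫ k in brillouin 4, g (![k 2, k 3, k 0, k 1] : Fin 4 → ℝ) = ∫ k in brillouin 4, g k := by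
  have h := measurePreserving_swapPairs.setIntegral_preimage_emb measurableEmbedding_swapPairs g
    (brillouin 4)
  rwa [swapPairs_preimage_brillouin] at h

/-! ### The direction symbol: `s₀₁ + s₂₃ = 1` almost everywhere -/

/-- Lebesgue-almost every momentum has `k̂² = Σ_μ (2 sin(k_μ/2))² ≠ 0` (the exceptional set lies in
the null hyperplane family `{sin(k₀/2) = 0} = {k₀ ∈ 2πℤ}`). [folklore] -/
theorem ae_latticeMomentumSq_ne_zero :
    ∀ᵐ k ∂(volume : Measure (Fin 4 → ℝ)), (∑ i : Fin 4, (2 * Real.sin (k i / 2)) ^ 2) ≠ 0 := by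
  have hnull : (volume : Measure (Fin 4 → ℝ))
      (Function.eval (0 : Fin 4) ⁻¹' {t : ℝ | Real.sin (t / 2) = 0}) = 0 := by
    rw [volume_pi]
    apply Measure.pi_eval_preimage_null
    have hsub : {t : ℝ | Real.sin (t / 2) = 0} ⊆ Set.range (fun n : ℤ => (n : ℝ) * Real.pi * 2) := by
      intro t ht
      obtain ⟨n, hn⟩ := Real.sin_eq_zero_iff.1 ht
      exact ⟨n, by linarith⟩
    exact measure_mono_null hsub ((Set.countable_range _).measure_zero _)
  rw [← compl_mem_ae_iff] at hnull
  filter_upwards [hnull] with k hk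
  intro hsum
  apply hk
  have h0 : (2 * Real.sin (k 0 / 2)) ^ 2 = 0 :=
    (Finset.sum_eq_zero_iff_of_nonneg (fun i _ => sq_nonneg (2 * Real.sin (k i / 2)))).1 hsum 0
      (mem_univ _)
  simp only [Set.mem_preimage, Function.eval, Set.mem_setOf_eq]
  simpa using h0

/-- The direction symbols are bounded: `|cos(k·z) · (k̂₀²+k̂₁²)/k̂²| ≤ 1` and the same for the
transverse pair (junk value `0` at `k̂² = 0` included). [folklore] -/
theorem abs_cos_mul_symbol_le_one (a : ℝ) (k : Fin 4 → ℝ) (i j : Fin 4) (hij : i ≠ j) :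
    |Real.cos a * (((2 * Real.sin (k i / 2)) ^ 2 + (2 * Real.sin (k j / 2)) ^ 2) /
        (∑ l : Fin 4, (2 * Real.sin (k l / 2)) ^ 2))| ≤ 1 := by
  have hnum : 0 ≤ (2 * Real.sin (k i / 2)) ^ 2 + (2 * Real.sin (k j / 2)) ^ 2 := by positivity
  have hden : 0 ≤ ∑ l : Fin 4, (2 * Real.sin (k l / 2)) ^ 2 := sum_nonneg fun l _ => sq_nonneg _
  have hle : (2 * Real.sin (k i / 2)) ^ 2 + (2 * Real.sin (k j / 2)) ^ 2 ≤
      ∑ l : Fin 4, (2 * Real.sin (k l / 2)) ^ 2 := by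
    rw [← Finset.sum_pair (f := fun l => (2 * Real.sin (k l / 2)) ^ 2) hij]
    exact Finset.sum_le_sum_of_subset_of_nonneg (Finset.subset_univ _) fun l _ _ => sq_nonneg _
  have hfrac : |((2 * Real.sin (k i / 2)) ^ 2 + (2 * Real.sin (k j / 2)) ^ 2) /
      (∑ l : Fin 4, (2 * Real.sin (k l / 2)) ^ 2)| ≤ 1 := by
    rw [abs_of_nonneg (div_nonneg hnum hden)]
    exact div_le_one_of_le₀ hle hden
  rw [abs_mul]
  calc |Real.cos a| * |((2 * Real.sin (k i / 2)) ^ 2 + (2 * Real.sin (k j / 2)) ^ 2) /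
          (∑ l : Fin 4, (2 * Real.sin (k l / 2)) ^ 2)|
      ≤ 1 * 1 := mul_le_mul (Real.abs_cos_le_one a) hfrac (abs_nonneg _) zero_le_one
    _ = 1 := one_mul 1

/-- Integrability on the Brillouin zone of the dipole integrands `cos(k·z) · (k̂ᵢ²+k̂ⱼ²)/k̂²`
(bounded and measurable on a set of finite measure). [folklore] -/
theorem integrableOn_cos_mul_symbol (z : Site 4) (i j : Fin 4) (hij : i ≠ j) :
    IntegrableOn (fun k : Fin 4 → ℝ => Real.cos (∑ l : Fin 4, k l * (z l : ℝ)) *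
        (((2 * Real.sin (k i / 2)) ^ 2 + (2 * Real.sin (k j / 2)) ^ 2) /
          (∑ l : Fin 4, (2 * Real.sin (k l / 2)) ^ 2))) (brillouin 4) volume := by
  refine Measure.integrableOn_of_bounded (M := 1) ((isCompact_brillouin 4).measure_lt_top).ne ?_ ?_
  · refine Measurable.aestronglyMeasurable ?_
    refine Measurable.mul (by fun_prop) (Measurable.div (by fun_prop) (by fun_prop))
  · exact Filter.Eventually.of_forall fun k => by
      rw [Real.norm_eq_abs]; exact abs_cos_mul_symbol_le_one _ k i j hij

/-! ### `K(z) + K(Tz) = [z = 0]` -/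

/-- **The swap identity for the free dipole kernel**: with
`K(z) = (2π)⁻⁴ ∫_{[-π,π]⁴} cos(k·z) (k̂₀²+k̂₁²)/k̂² dk` and `Tz = (z₂,z₃,z₀,z₁)`,
`K(z) + K(Tz) = [z = 0]` — change variables by the coordinate-pair swap in the second integral
(`s₀₁ ∘ T = s₂₃`), add (`s₀₁ + s₂₃ = 1` a.e.) and use orthogonality of characters on `[-π,π]⁴`.
[folklore] -/
theorem freeDipoleKernel_add_swap (z : Site 4) :
    (1 / (2 * Real.pi) ^ 4 * ∫ k in Set.pi Set.univ (fun _ : Fin 4 => Set.Icc (-Real.pi) Real.pi),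
        Real.cos (∑ i : Fin 4, k i * (z i : ℝ)) *
          (((2 * Real.sin (k 0 / 2)) ^ 2 + (2 * Real.sin (k 1 / 2)) ^ 2) /
            (∑ i : Fin 4, (2 * Real.sin (k i / 2)) ^ 2))) +
      (1 / (2 * Real.pi) ^ 4 * ∫ k in Set.pi Set.univ (fun _ : Fin 4 => Set.Icc (-Real.pi) Real.pi),
        Real.cos (∑ i : Fin 4, k i * ((![z 2, z 3, z 0, z 1] : Site 4) i : ℝ)) *
          (((2 * Real.sin (k 0 / 2)) ^ 2 + (2 * Real.sin (k 1 / 2)) ^ 2) /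
            (∑ i : Fin 4, (2 * Real.sin (k i / 2)) ^ 2))) =
      if z = 0 then 1 else 0 := by
  rw [← SRW.brillouin_eq_pi]
  -- the second integral, after the change of variables `k ↦ Tk`, has the transverse symbol
  have h2 : ∫ k in brillouin 4, Real.cos (∑ i : Fin 4, k i * ((![z 2, z 3, z 0, z 1] : Site 4) i : ℝ)) *
        (((2 * Real.sin (k 0 / 2)) ^ 2 + (2 * Real.sin (k 1 / 2)) ^ 2) /
          (∑ i : Fin 4, (2 * Real.sin (k i / 2)) ^ 2)) =
      ∫ k in brillouin 4, Real.cos (∑ i : Fin 4, k i * (z i : ℝ)) *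
        (((2 * Real.sin (k 2 / 2)) ^ 2 + (2 * Real.sin (k 3 / 2)) ^ 2) /
          (∑ i : Fin 4, (2 * Real.sin (k i / 2)) ^ 2)) := by
    rw [← setIntegral_brillouin_comp_swapPairs (fun k => Real.cos (∑ i : Fin 4, k i * (z i : ℝ)) *
        (((2 * Real.sin (k 2 / 2)) ^ 2 + (2 * Real.sin (k 3 / 2)) ^ 2) /
          (∑ i : Fin 4, (2 * Real.sin (k i / 2)) ^ 2)))]
    refine setIntegral_congr_fun (measurableSet_brillouin 4) fun k _ => ?_
    simp only [Fin.sum_univ_four, Matrix.cons_val_zero, Matrix.cons_val_one, Matrix.cons_val]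
    ring_nf
  have h3 : ∫ k in brillouin 4, (Real.cos (∑ i : Fin 4, k i * (z i : ℝ)) *
        (((2 * Real.sin (k 0 / 2)) ^ 2 + (2 * Real.sin (k 1 / 2)) ^ 2) /
          (∑ i : Fin 4, (2 * Real.sin (k i / 2)) ^ 2)) +
        Real.cos (∑ i : Fin 4, k i * (z i : ℝ)) *
        (((2 * Real.sin (k 2 / 2)) ^ 2 + (2 * Real.sin (k 3 / 2)) ^ 2) /
          (∑ i : Fin 4, (2 * Real.sin (k i / 2)) ^ 2))) =
      ∫ k in brillouin 4, Real.cos (∑ i : Fin 4, k i * (z i : ℝ)) := by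
    refine integral_congr_ae ?_
    filter_upwards [ae_restrict_of_ae (s := brillouin 4) ae_latticeMomentumSq_ne_zero] with k hk
    rw [← mul_add, ← add_div]
    have hS : (2 * Real.sin (k 0 / 2)) ^ 2 + (2 * Real.sin (k 1 / 2)) ^ 2 +
        ((2 * Real.sin (k 2 / 2)) ^ 2 + (2 * Real.sin (k 3 / 2)) ^ 2) =
        ∑ i : Fin 4, (2 * Real.sin (k i / 2)) ^ 2 := by
      simp only [Fin.sum_univ_four]; ring
    rw [hS, div_self hk, mul_one]
  rw [h2, ← mul_add, ← integral_add (integrableOn_cos_mul_symbol z 0 1 (by decide))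
    (integrableOn_cos_mul_symbol z 2 3 (by decide)), h3, integral_brillouin_cos_sum_mul]
  have hπ : (2 * Real.pi) ^ 4 ≠ 0 := by positivity
  split_ifs
  · field_simp
  · rw [mul_zero]

/-! ### The lattice side: `Σ_{x,y∈B_N} K(x−y) = #B_N / 2` -/

/-- The cube `B_N = {-N,…,N}⁴` is invariant under the coordinate-pair swap of sites. [folklore] -/
theorem swapPairs_mem_box_iff (N : ℕ) (x : Site 4) :
    (![x 2, x 3, x 0, x 1] : Site 4) ∈ box 4 N ↔ x ∈ box 4 N := by
  simp only [mem_box]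
  constructor
  · intro h i
    fin_cases i
    · simpa using h 2
    · simpa using h 3
    · simpa using h 0
    · simpa using h 1
  · intro h i
    fin_cases i
    · simpa using h 2
    · simpa using h 3
    · simpa using h 0
    · simpa using h 1

/-- **Double box sums of a kernel with the swap identity**: if `K(z) + K(Tz) = [z = 0]` for the
coordinate-pair swap `T`, then `Σ_{x,y∈B_N} K(x−y) = #B_N/2` for every `N` (reindex both sums by
the involution `T`, which preserves `B_N` and commutes with subtraction, and add). [folklore] -/
theorem sum_sum_box_eq_half_card_of_add_swap (K : Site 4 → ℝ)
    (hK : ∀ z : Site 4, K z + K (![z 2, z 3, z 0, z 1] : Site 4) = if z = 0 then 1 else 0) (N : ℕ) :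
    ∑ x ∈ box 4 N, ∑ y ∈ box 4 N, K (x - y) = ((box 4 N).card : ℝ) / 2 := by
  -- the site swap as an equivalence (an involution)
  have hinv : ∀ x : Site 4, (![(![x 2, x 3, x 0, x 1] : Site 4) 2, (![x 2, x 3, x 0, x 1] : Site 4) 3,
      (![x 2, x 3, x 0, x 1] : Site 4) 0, (![x 2, x 3, x 0, x 1] : Site 4) 1] : Site 4) = x := by
    intro x; funext i; fin_cases i <;> simp
  let e : Site 4 ≃ Site 4 :=
    { toFun := fun x => (![x 2, x 3, x 0, x 1] : Site 4)
      invFun := fun x => (![x 2, x 3, x 0, x 1] : Site 4)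
      left_inv := hinv
      right_inv := hinv }
  have hswap : ∑ x ∈ box 4 N, ∑ y ∈ box 4 N, K (x - y) =
      ∑ x ∈ box 4 N, ∑ y ∈ box 4 N, K (![(x - y) 2, (x - y) 3, (x - y) 0, (x - y) 1] : Site 4) := by
    refine Finset.sum_equiv e (fun x => (swapPairs_mem_box_iff N x).symm) fun x _ => ?_
    refine Finset.sum_equiv e (fun y => (swapPairs_mem_box_iff N y).symm) fun y _ => ?_
    congr 1
    funext i
    fin_cases i <;> simp [e]
  have hrow : ∀ x ∈ box 4 N, (∑ y ∈ box 4 N, K (x - y)) +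
      ∑ y ∈ box 4 N, K (![(x - y) 2, (x - y) 3, (x - y) 0, (x - y) 1] : Site 4) = 1 := by
    intro x hx
    rw [← Finset.sum_add_distrib]
    simp_rw [hK, sub_eq_zero]
    rw [Finset.sum_ite_eq, if_pos hx]
  have hadd : 2 * ∑ x ∈ box 4 N, ∑ y ∈ box 4 N, K (x - y) = (box 4 N).card := by
    rw [two_mul]
    nth_rewrite 2 [hswap]
    rw [← Finset.sum_add_distrib, Finset.sum_congr rfl hrow]
    simp
  linarith

/-- **The box mean of the free dipole kernel is exactly `1/2` for every `N`.** [folklore] -/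
theorem freeDipoleBoxMean_eq_half (N : ℕ) :
    (∑ x ∈ box 4 N, ∑ y ∈ box 4 N,
        (fun z : Site 4 => (1 / (2 * Real.pi) ^ 4) *
          ∫ k in Set.pi Set.univ (fun _ : Fin 4 => Set.Icc (-Real.pi) Real.pi),
            Real.cos (∑ i : Fin 4, k i * (z i : ℝ)) *
              (((2 * Real.sin (k 0 / 2)) ^ 2 + (2 * Real.sin (k 1 / 2)) ^ 2) /
                (∑ i : Fin 4, (2 * Real.sin (k i / 2)) ^ 2))) (x - y)) /
      ((box 4 N).card : ℝ) = 1 / 2 := by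
  rw [sum_sum_box_eq_half_card_of_add_swap _ (fun z => freeDipoleKernel_add_swap z) N]
  have hcard : ((box 4 N).card : ℝ) ≠ 0 := by
    exact_mod_cast (box_nonempty 4 N).card_pos.ne'
  field_simp

/-- **Support item stmt-QuantumFields-25882 `FreeDipoleBoxMeanHalf`, proved**: the box average of
the free lattice photon kernel `K(z) = (2π)⁻⁴∫_{[-π,π]⁴} cos(k·z)(k̂₀²+k̂₁²)/k̂² dk` over
`B_N = {-N,…,N}⁴` tends to `1/2` — in fact it EQUALS `1/2` for every `N` (`freeDipoleBoxMean_eq_half`).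
This is an elementary lattice-Fourier lemma of the abelian comparison line `U1DipoleHelicity`; it
proves nothing about the Yang–Mills mass gap. [folklore] -/
theorem freeDipoleBoxMeanHalf_proof :
    Summit.QuantumFields.YangMills.Theses.U1DipoleHelicity.FreeDipoleBoxMeanHalf := by
  unfold Summit.QuantumFields.YangMills.Theses.U1DipoleHelicity.FreeDipoleBoxMeanHalf
  refine (tendsto_const_nhds (x := (1 / 2 : ℝ))).congr fun N => ?_
  exact (freeDipoleBoxMean_eq_half N).symm

end Summit.QuantumFields.YangMills.Theorems.U1DipoleHelicity
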